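import Summits.BirchSwinnertonDyer.BirchSwinnertonDyer.Theorems.ResidualThetaTransportAtTwoHeckeThetaPartnerAdicAtTwoThetaCosetIdeal
import Literature.NumberTheory.EllipticCurves.CMNewformHeckeRecursionProofs
import HarnessLib

/-!
# The Hecke theta series of one ideal class: the law with character `κ(d)χ(d)` (toward K0⁺, stmt-20690)

Route `ResidualThetaTransportAtTwo`, crux K0⁺ `HeckeThetaPartnerAdicAtTwo` (stmt-BirchSwinnertonDyer-20690),
line "Hecke theta series from the genus-two Riemann theta function".  THEOREMS ONLY.

`K` imaginary quadratic, `σ : K → ℂ`, `𝔪 ≠ 0`, `M = N𝔪`, `ψ` the prime values of a weight-2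
Größencharakter mod `𝔪` (`ψ̃((b)) = ψ̃((c)) σ(b/c)` for `b ≡ c mod 𝔪`, `(c) + 𝔪 = 1`), and
`χ(x) = ψ̃_𝔪((x))/σ(x)` (`ψ̃_𝔪 = rayClassCoeff 𝔪 ψ`, zero off the ideals prime to `𝔪`).  For a
class representative `𝔞` and `𝔟 = 𝔞𝔪` with Gram data `(b, B)`, the class theta series is
`F_𝔞(τ) = Σ_{x₀ ∈ 𝔞/𝔟} χ(x₀) Θ(τ; x₀ + 𝔟)` (`Θ` the coset theta of `ThetaCosetIdeal`, which
vanishes on `𝔟` and depends only on the coset).  Main result (`classTheta_moeb`): for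
`γ = (a b; c d) ∈ Γ₀(|d_K|·M)`, `F_𝔞(γτ) = κ(d) χ(d) (cτ+d)² F_𝔞(τ)` — the substitution
`x₀ ↦ a·x₀` on `𝔞/𝔟` (`d a ≡ 1 mod M`), the law of `ThetaCosetIdeal`, the `𝔪`-periodicity and
multiplicativity of `χ`.

BSD is not proved by this file.
-/

set_option autoImplicit false
set_option linter.dupNamespace false

noncomputable section

open scoped NumberField ComplexConjugate Real MatrixGroups UpperHalfPlane
open NumberField Module Matrix Complex Filter IsDedekindDomain

namespace Summit.BirchSwinnertonDyer.BirchSwinnertonDyer.Theorems.HeckeTheta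

open Literature.Analysis.SpecialFunctions
open Literature.NumberTheory.ModularForms.BinaryTheta
open Literature.NumberTheory.Automorphic (siegelUpperHalfSpace mem_siegelUpperHalfSpace_iff)
open Literature.NumberTheory.LFunctions (idealPow rayClassCoeff)
open Literature.NumberTheory.EllipticCurves.ModularForms (rayClassCoeff_mul_of_ne_bot)

variable {K : Type} [Field K] [NumberField K]

/-! ### The coset theta vanishes on the trivial coset -/

/-- **`∇ϑ[0; 0](0, Ω) = 0`**: `ϑ[0;0](·, Ω)` is even. -/
theorem fderiv_riemannThetaChar_zero_zero (Ω : Matrix (Fin 2) (Fin 2) ℂ) (hΩ : ∀ i j, Ω i j = Ω j i)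
    {c : ℝ} (hc : 0 < c) (hY : ∀ x : Fin 2 → ℝ, c * ∑ i, x i ^ 2 ≤ ∑ i, ∑ j, x i * (Ω i j).im * x j) :
    fderiv ℂ (riemannThetaChar 0 0 Ω) 0 = 0 := by
  have hd : DifferentiableAt ℂ (riemannThetaChar 0 0 Ω) 0 :=
    (differentiable_riemannThetaChar Ω hΩ hc hY 0 0) 0
  have heven : (fun z => riemannThetaChar 0 0 Ω (-z)) = riemannThetaChar 0 0 Ω := by
    funext z; rw [riemannThetaChar_neg, neg_zero]
  have hcomp : HasFDerivAt (fun z => riemannThetaChar 0 0 Ω (-z))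
      ((fderiv ℂ (riemannThetaChar 0 0 Ω) 0).comp (-ContinuousLinearMap.id ℂ (Fin 2 → ℂ))) 0 := by
    have h1 : HasFDerivAt (fun z : Fin 2 → ℂ => -z) (-ContinuousLinearMap.id ℂ (Fin 2 → ℂ)) 0 :=
      (hasFDerivAt_id (0 : Fin 2 → ℂ)).neg
    have h2 : HasFDerivAt (riemannThetaChar 0 0 Ω) (fderiv ℂ (riemannThetaChar 0 0 Ω) 0) (-(0 : Fin 2 → ℂ)) := by
      rw [neg_zero]; exact hd.hasFDerivAt
    exact h2.comp 0 h1
  rw [heven] at hcomp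
  have h := hcomp.fderiv
  ext1 v
  have hv := congrArg (fun L : (Fin 2 → ℂ) →L[ℂ] ℂ => L v) h
  simp only [ContinuousLinearMap.comp_apply, _root_.neg_apply,
    ContinuousLinearMap.id_apply, map_neg, _root_.zero_apply] at hv ⊢
  have : fderiv ℂ (riemannThetaChar 0 0 Ω) 0 v + fderiv ℂ (riemannThetaChar 0 0 Ω) 0 v = 0 := by
    linear_combination hv
  exact add_self_eq_zero.mp this

omit [NumberField K] in
/-- **The coset theta vanishes on `𝔟`**: if `x₀ ∈ 𝔟` then its characteristic `k/M` is integral and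
`∇ϑ[k/M; 0](0, τ'·B) = ∇ϑ[0; 0](0, τ'·B) = 0`. -/
theorem fderiv_thetaCoset_eq_zero_of_mem {𝔟 : Ideal (𝓞 K)} (b : Basis (Fin 2) ℤ 𝔟)
    {B : Matrix (Fin 2) (Fin 2) ℤ} (hsymm : B.IsSymm) (hpos : (B.map (Int.cast : ℤ → ℝ)).PosDef)
    {M : ℕ} (hM : M ≠ 0) {x₀ : 𝓞 K} (hx₀ : x₀ ∈ 𝔟) {k : Fin 2 → ℤ}
    (hk : ((b.equivFun.symm k : 𝔟) : 𝓞 K) = (M : 𝓞 K) * x₀) {τ : ℂ} (hτ : 0 < τ.im) :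
    fderiv ℂ (riemannThetaChar (fun i => (k i : ℂ) / M) 0 (τ • B.map ((↑) : ℤ → ℂ))) 0 = 0 := by
  have hk0 : ((b.equivFun.symm 0 : 𝔟) : 𝓞 K) = (M : 𝓞 K) * 0 := by simp
  have hy : x₀ - 0 ∈ 𝔟 := by rw [sub_zero]; exact hx₀
  have hfun : riemannThetaChar (fun i => (k i : ℂ) / M) 0 (τ • B.map ((↑) : ℤ → ℂ)) =
      riemannThetaChar 0 0 (τ • B.map ((↑) : ℤ → ℂ)) := by
    funext z
    rw [riemannThetaChar_coset_eq_of_sub_mem b hM hk0 hk hy]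
    congr 1
    funext i; simp
  rw [hfun]
  have hZ := smul_mem_siegelUpperHalfSpace hsymm hpos hτ
  obtain ⟨c, hc, hY⟩ := exists_pos_mul_sum_sq_le_of_posDef_im _ hZ.2
  exact fderiv_riemannThetaChar_zero_zero _ (fun i j => (hZ.1.apply i j).symm) hc hY

/-! ### The character `χ(x) = ψ̃_𝔪((x))/σ(x)` -/

/-- **`𝔪`-periodicity of `χ`**: for nonzero `x, x'` with `x - x' ∈ 𝔪`,
`ψ̃_𝔪((x))/σ(x) = ψ̃_𝔪((x'))/σ(x')` (the Größencharakter relation when `(x') + 𝔪 = 1`; both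
sides vanish otherwise). -/
theorem chi_periodic (σ : K →+* ℂ) {𝔪 : Ideal (𝓞 K)} {ψ : HeightOneSpectrum (𝓞 K) → ℂ}
    (hψ : ∀ b c : 𝓞 K, b ≠ 0 → c ≠ 0 → IsCoprime (Ideal.span {c}) 𝔪 → b - c ∈ 𝔪 →
      idealPow K ψ (Ideal.span {b}) = idealPow K ψ (Ideal.span {c}) * σ ((b : K) / c))
    {x x' : 𝓞 K} (hx : x ≠ 0) (hx' : x' ≠ 0) (hxx' : x - x' ∈ 𝔪) :
    rayClassCoeff 𝔪 ψ (Ideal.span {x}) / σ (x : K) = rayClassCoeff 𝔪 ψ (Ideal.span {x'}) / σ (x' : K) := by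
  classical
  have hσx : σ (x : K) ≠ 0 := by
    rw [map_ne_zero]; exact_mod_cast hx
  have hσx' : σ (x' : K) ≠ 0 := by
    rw [map_ne_zero]; exact_mod_cast hx'
  have hsx : Ideal.span {x} ≠ ⊥ := by rw [Ne, Ideal.span_singleton_eq_bot]; exact hx
  have hsx' : Ideal.span {x'} ≠ ⊥ := by rw [Ne, Ideal.span_singleton_eq_bot]; exact hx'
  -- coprimality is the same for `x` and `x'`
  have hiff : ∀ {y y' : 𝓞 K}, y - y' ∈ 𝔪 → IsCoprime (Ideal.span {y'}) 𝔪 → IsCoprime (Ideal.span {y}) 𝔪 := by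
    intro y y' h hc
    rw [Ideal.isCoprime_iff_sup_eq] at hc ⊢
    rw [eq_top_iff, ← hc, sup_le_iff]
    refine ⟨?_, le_sup_right⟩
    rw [Ideal.span_singleton_le_iff_mem]
    have : y' = y - (y - y') := by ring
    rw [this]
    exact Ideal.sub_mem _ (Ideal.mem_sup_left (Ideal.mem_span_singleton_self y))
      (Ideal.mem_sup_right h)
  by_cases hc : IsCoprime (Ideal.span {x'}) 𝔪
  · have hc2 : IsCoprime (Ideal.span {x}) 𝔪 := hiff hxx' hc
    rw [rayClassCoeff, if_pos ⟨hsx, hc2⟩, rayClassCoeff, if_pos ⟨hsx', hc⟩, hψ x x' hx hx' hc hxx',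
      map_div₀]
    field_simp
  · have hc2 : ¬ IsCoprime (Ideal.span {x}) 𝔪 := fun h => hc (hiff (by
      have : x' - x = -(x - x') := by ring
      rw [this]; exact 𝔪.neg_mem hxx') h)
    rw [rayClassCoeff, if_neg (not_and.mpr fun _ => hc2), rayClassCoeff,
      if_neg (not_and.mpr fun _ => hc), zero_div, zero_div]

/-- **Multiplicativity of `χ`** on nonzero elements: `χ(x y) = χ(x) χ(y)`. -/
theorem chi_mul (σ : K →+* ℂ) (𝔪 : Ideal (𝓞 K)) (ψ : HeightOneSpectrum (𝓞 K) → ℂ)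
    {x y : 𝓞 K} (hx : x ≠ 0) (hy : y ≠ 0) :
    rayClassCoeff 𝔪 ψ (Ideal.span {x * y}) / σ ((x * y : 𝓞 K) : K) =
      (rayClassCoeff 𝔪 ψ (Ideal.span {x}) / σ (x : K)) * (rayClassCoeff 𝔪 ψ (Ideal.span {y}) / σ (y : K)) := by
  have hsx : Ideal.span {x} ≠ ⊥ := by rw [Ne, Ideal.span_singleton_eq_bot]; exact hx
  have hsy : Ideal.span {y} ≠ ⊥ := by rw [Ne, Ideal.span_singleton_eq_bot]; exact hy
  rw [← Ideal.span_singleton_mul_span_singleton, rayClassCoeff_mul_of_ne_bot 𝔪 ψ hsx hsy]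
  push_cast
  rw [map_mul, mul_div_mul_comm]

/-- `χ(0) = 0`. -/
theorem chi_zero (σ : K →+* ℂ) (𝔪 : Ideal (𝓞 K)) (ψ : HeightOneSpectrum (𝓞 K) → ℂ) :
    rayClassCoeff 𝔪 ψ (Ideal.span {(0 : 𝓞 K)}) / σ ((0 : 𝓞 K) : K) = 0 := by
  simp


/-! ### The class theta series and its law -/

omit [NumberField K] in
/-- Coordinates scale: if `Σ kᵢbᵢ = M x` then `Σ (d kᵢ) bᵢ = M (d x)`. -/
theorem coe_equivFun_symm_intCast_mul {𝔟 : Ideal (𝓞 K)} (b : Basis (Fin 2) ℤ 𝔟) {M : ℕ} {x : 𝓞 K}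
    {k : Fin 2 → ℤ} (hk : ((b.equivFun.symm k : 𝔟) : 𝓞 K) = (M : 𝓞 K) * x) (d : ℤ) :
    ((b.equivFun.symm (fun i => d * k i) : 𝔟) : 𝓞 K) = (M : 𝓞 K) * ((d : 𝓞 K) * x) := by
  have h : (fun i => d * k i) = d • k := by funext i; simp
  rw [h, LinearEquiv.map_smul, Submodule.coe_smul_of_tower, zsmul_eq_mul, hk]
  ring

/-- **The law of the class theta series `F_𝔞(τ) = Σ_{x₀ ∈ 𝔞/𝔟} χ(x₀) Θ(τ; x₀ + 𝔟)` on
`Γ₀(|d_K|·M)`**: `F_𝔞(γτ) = κ(d) χ(d) (cτ+d)² F_𝔞(τ)` for `γ = (a b; c d)` with `|d_K|·M ∣ c`.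
Here `Θ` is any function agreeing on `𝔞` with the coset gradient theta of `ThetaCosetIdeal` and
vanishing off `𝔞`, `ρ` any choice of representatives of `𝓞 K/𝔟`, and `χ(x) = ψ̃_𝔪((x))/σ(x)`.
Proof: reindex `𝔞/𝔟` by `x₀ ↦ a x₀` (inverse `x₀ ↦ d x₀`, as `ad ≡ 1 mod M` and `M𝔞 ⊆ 𝔟`), use
`Θ(γτ; d x₁ + 𝔟) = κ(d)(cτ+d)² Θ(τ; x₁ + 𝔟)` (`fderiv_thetaCoset_apply_moeb`) and
`χ(d x₁) = χ(d) χ(x₁)`, `χ(x₀) = χ(d x₁)` for `x₀ ≡ d x₁ mod 𝔟`. -/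
theorem classTheta_moeb (hK : finrank ℚ K = 2) [IsTotallyComplex K] (σ : K →+* ℂ)
    {κ : DirichletCharacter ℂ (discr K).natAbs} (hprim : κ.IsPrimitive) (hodd : κ.Odd)
    (hquad : κ ^ 2 = 1)
    (hζ : ∀ s : ℂ, 1 < s.re → NumberField.dedekindZeta K s = riemannZeta s * LSeries (fun n => κ n) s)
    {𝔪 : Ideal (𝓞 K)} (h𝔪 : 𝔪 ≠ ⊥) {ψ : HeightOneSpectrum (𝓞 K) → ℂ}
    (hψ : ∀ b c : 𝓞 K, b ≠ 0 → c ≠ 0 → IsCoprime (Ideal.span {c}) 𝔪 → b - c ∈ 𝔪 →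
      idealPow K ψ (Ideal.span {b}) = idealPow K ψ (Ideal.span {c}) * σ ((b : K) / c))
    {𝔞 𝔟 : Ideal (𝓞 K)} (h𝔟 : 𝔟 = 𝔞 * 𝔪) (h𝔞 : 𝔞 ≠ ⊥) (b : Basis (Fin 2) ℤ 𝔟)
    {B : Matrix (Fin 2) (Fin 2) ℤ}
    (hB : ∀ i j, ((B i j : ℤ) : ℂ) * ((Ideal.absNorm 𝔟 : ℕ) : ℂ) =
      σ ((b i : 𝓞 K) : K) * conj (σ ((b j : 𝓞 K) : K)) + conj (σ ((b i : 𝓞 K) : K)) * σ ((b j : 𝓞 K) : K))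
    (hsymm : B.IsSymm) (h00 : Even (B 0 0)) (h11 : Even (B 1 1))
    (hdet : B.det = ((discr K).natAbs : ℤ)) (hpos : (B.map (Int.cast : ℤ → ℝ)).PosDef)
    (Θ : 𝓞 K → ℍ → ℂ)
    (hΘ : ∀ x₀ ∈ 𝔞, ∀ k : Fin 2 → ℤ, ((b.equivFun.symm k : 𝔟) : 𝓞 K) = (Ideal.absNorm 𝔪 : 𝓞 K) * x₀ →
      ∀ τ : ℍ, Θ x₀ τ = fderiv ℂ (riemannThetaChar (fun i => (k i : ℂ) / (Ideal.absNorm 𝔪 : ℕ)) 0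
        ((((Ideal.absNorm 𝔪 : ℕ) : ℂ) * (τ : ℂ)) • B.map ((↑) : ℤ → ℂ))) 0
        (fun i => σ ((b i : 𝓞 K) : K)))
    (hΘ0 : ∀ x₀, x₀ ∉ 𝔞 → ∀ τ : ℍ, Θ x₀ τ = 0)
    (ρ : 𝓞 K ⧸ 𝔟 → 𝓞 K) (hρ : ∀ q, Ideal.Quotient.mk 𝔟 (ρ q) = q) [Fintype (𝓞 K ⧸ 𝔟)]
    (F : ℍ → ℂ)
    (hF : ∀ τ, F τ = ∑ q : 𝓞 K ⧸ 𝔟,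
      rayClassCoeff 𝔪 ψ (Ideal.span {ρ q}) / σ (ρ q : K) * Θ (ρ q) τ)
    {γ : SL(2, ℤ)} (hγ : (((discr K).natAbs * Ideal.absNorm 𝔪 : ℕ) : ℤ) ∣ (γ 1 0 : ℤ)) (τ : ℍ) :
    F (γ • τ) = κ ((γ 1 1 : ℤ) : ZMod (discr K).natAbs) *
      (rayClassCoeff 𝔪 ψ (Ideal.span {((γ 1 1 : ℤ) : 𝓞 K)}) / σ (((γ 1 1 : ℤ) : 𝓞 K) : K)) *
      (((γ 1 0 : ℤ) : ℂ) * (τ : ℂ) + ((γ 1 1 : ℤ) : ℂ)) ^ 2 * F τ := by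
  classical
  set M : ℕ := Ideal.absNorm 𝔪 with hMdef
  have hM : M ≠ 0 := by rw [hMdef, Ne, Ideal.absNorm_eq_zero_iff]; exact h𝔪
  have hMpos : 0 < M := Nat.pos_of_ne_zero hM
  have h𝔟𝔞 : 𝔟 ≤ 𝔞 := by rw [h𝔟]; exact Ideal.mul_le_right
  have h𝔟𝔪 : 𝔟 ≤ 𝔪 := by rw [h𝔟]; exact Ideal.mul_le_left
  -- entries of `γ`
  have hdetγ := Matrix.SpecialLinearGroup.det_coe γ
  rw [Matrix.det_fin_two] at hdetγ
  have hMc : (M : ℤ) ∣ (γ 1 0 : ℤ) := dvd_trans ⟨((discr K).natAbs : ℤ), by push_cast; ring⟩ hγ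
  obtain ⟨c', hc'⟩ := hMc
  -- `c x₀ ∈ 𝔟` for `x₀ ∈ 𝔞`
  have hcx : ∀ x₀ ∈ 𝔞, ((γ 1 0 : ℤ) : 𝓞 K) * x₀ ∈ 𝔟 := by
    intro x₀ hx₀
    rw [hc', Int.cast_mul, Int.cast_natCast, mul_comm (M : 𝓞 K), mul_assoc, h𝔟, mul_comm 𝔞]
    exact Ideal.mul_mem_left _ _ (Ideal.mul_mem_mul (Ideal.absNorm_mem 𝔪) hx₀)
  -- membership in `𝔞̄ = 𝔞/𝔟`
  set S : Finset (𝓞 K ⧸ 𝔟) := Finset.univ.filter fun q => q ∈ 𝔞.map (Ideal.Quotient.mk 𝔟) with hS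
  have hmemS : ∀ q, q ∈ S ↔ ρ q ∈ 𝔞 := by
    intro q
    rw [hS, Finset.mem_filter, ← Ideal.mem_quotient_iff_mem h𝔟𝔞, hρ]
    simp
  -- the reindexing maps
  set ia : 𝓞 K ⧸ 𝔟 → 𝓞 K ⧸ 𝔟 := fun q => Ideal.Quotient.mk 𝔟 ((γ 0 0 : ℤ) : 𝓞 K) * q with hia
  set jd : 𝓞 K ⧸ 𝔟 → 𝓞 K ⧸ 𝔟 := fun q => Ideal.Quotient.mk 𝔟 ((γ 1 1 : ℤ) : 𝓞 K) * q with hjd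
  have hbc : ∀ q ∈ S, Ideal.Quotient.mk 𝔟 (((γ 0 1 : ℤ) : 𝓞 K) * ((γ 1 0 : ℤ) : 𝓞 K)) * q = 0 := by
    intro q hq
    rw [← hρ q, ← map_mul, Ideal.Quotient.eq_zero_iff_mem, mul_assoc]
    exact Ideal.mul_mem_left _ _ (hcx _ ((hmemS q).mp hq))
  have had : Ideal.Quotient.mk 𝔟 ((γ 1 1 : ℤ) : 𝓞 K) * Ideal.Quotient.mk 𝔟 ((γ 0 0 : ℤ) : 𝓞 K) =
      1 + Ideal.Quotient.mk 𝔟 (((γ 0 1 : ℤ) : 𝓞 K) * ((γ 1 0 : ℤ) : 𝓞 K)) := by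
    rw [← map_mul, ← (Ideal.Quotient.mk 𝔟).map_one, ← map_add]
    congr 1
    have h := congrArg (fun z : ℤ => (z : 𝓞 K)) hdetγ
    push_cast at h
    linear_combination h
  have hS_ia : ∀ q ∈ S, ia q ∈ S := by
    intro q hq
    rw [hS, Finset.mem_filter] at hq ⊢
    exact ⟨Finset.mem_univ _, Ideal.mul_mem_left _ _ hq.2⟩
  have hS_jd : ∀ q ∈ S, jd q ∈ S := by
    intro q hq
    rw [hS, Finset.mem_filter] at hq ⊢
    exact ⟨Finset.mem_univ _, Ideal.mul_mem_left _ _ hq.2⟩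
  have hji : ∀ q ∈ S, jd (ia q) = q := by
    intro q hq
    simp only [hia, hjd]
    rw [← mul_assoc, had, add_mul, one_mul, hbc q hq, add_zero]
  have hij : ∀ q ∈ S, ia (jd q) = q := by
    intro q hq
    simp only [hia, hjd]
    rw [← mul_assoc, mul_comm (Ideal.Quotient.mk 𝔟 ((γ 0 0 : ℤ) : 𝓞 K)), had, add_mul, one_mul,
      hbc q hq, add_zero]
  -- the summand and its vanishing off `S`
  set g : 𝓞 K ⧸ 𝔟 → ℍ → ℂ := fun q τ' =>
    rayClassCoeff 𝔪 ψ (Ideal.span {ρ q}) / σ (ρ q : K) * Θ (ρ q) τ' with hg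
  have hg0 : ∀ τ' : ℍ, ∀ q, q ∉ S → g q τ' = 0 := by
    intro τ' q hq
    rw [hmemS] at hq
    simp only [hg, hΘ0 _ hq τ', mul_zero]
  have hsumS : ∀ τ' : ℍ, F τ' = ∑ q ∈ S, g q τ' := by
    intro τ'
    rw [hF τ', ← Finset.sum_filter_of_ne (p := fun q => q ∈ 𝔞.map (Ideal.Quotient.mk 𝔟))]
    intro q _ hne
    by_contra hq
    exact hne (hg0 τ' q (by rw [hS, Finset.mem_filter]; exact fun h => hq h.2))
  -- the constant
  set K₀ : ℂ := κ ((γ 1 1 : ℤ) : ZMod (discr K).natAbs) *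
      (rayClassCoeff 𝔪 ψ (Ideal.span {((γ 1 1 : ℤ) : 𝓞 K)}) / σ (((γ 1 1 : ℤ) : 𝓞 K) : K)) *
      (((γ 1 0 : ℤ) : ℂ) * (τ : ℂ) + ((γ 1 1 : ℤ) : ℂ)) ^ 2 with hK₀
  -- termwise identity
  have hterm : ∀ q ∈ S, g q (γ • τ) = K₀ * g (ia q) τ := by
    intro q hq
    have hx₀ : ρ q ∈ 𝔞 := (hmemS q).mp hq
    have hx₁ : ρ (ia q) ∈ 𝔞 := (hmemS _).mp (hS_ia q hq)
    -- `d x₁ ≡ x₀ mod 𝔟`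
    have hsub : ((γ 1 1 : ℤ) : 𝓞 K) * ρ (ia q) - ρ q ∈ 𝔟 := by
      rw [← Ideal.Quotient.eq, map_mul, hρ, hρ]
      exact hji q hq
    obtain ⟨k₀, hk₀⟩ := exists_coords h𝔟 b hx₀
    obtain ⟨k₁, hk₁⟩ := exists_coords h𝔟 b hx₁
    have hk₁' := coe_equivFun_symm_intCast_mul b hk₁ (γ 1 1 : ℤ)
    by_cases hq0 : q = 0
    · -- both representatives lie in `𝔟`: both theta values vanish
      have hx₀𝔟 : ρ q ∈ 𝔟 := by rw [← Ideal.Quotient.eq_zero_iff_mem, hρ]; exact hq0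
      have hia0 : ia q = 0 := by simp only [hia, hq0, mul_zero]
      have hx₁𝔟 : ρ (ia q) ∈ 𝔟 := by rw [← Ideal.Quotient.eq_zero_iff_mem, hρ]; exact hia0
      have h1 : Θ (ρ q) (γ • τ) = 0 := by
        rw [hΘ _ hx₀ k₀ hk₀]
        rw [fderiv_thetaCoset_eq_zero_of_mem b hsymm hpos hM hx₀𝔟 hk₀ (im_natCast_mul_pos hMpos _),
          _root_.zero_apply]
      have h2 : Θ (ρ (ia q)) τ = 0 := by
        rw [hΘ _ hx₁ k₁ hk₁]
        rw [fderiv_thetaCoset_eq_zero_of_mem b hsymm hpos hM hx₁𝔟 hk₁ (im_natCast_mul_pos hMpos _),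
          _root_.zero_apply]
      simp only [hg, h1, h2, mul_zero]
    · -- nonzero representatives
      have hx₀0 : ρ q ≠ 0 := by
        intro h; apply hq0; rw [← hρ q, h, map_zero]
      have hdx₁0 : ((γ 1 1 : ℤ) : 𝓞 K) * ρ (ia q) ≠ 0 := by
        intro h; apply hq0
        rw [← hji q hq]
        simp only [hjd]
        rw [← hρ (ia q), ← map_mul, h, map_zero]
      have hd0 : ((γ 1 1 : ℤ) : 𝓞 K) ≠ 0 := left_ne_zero_of_mul hdx₁0
      have hx₁0 : ρ (ia q) ≠ 0 := right_ne_zero_of_mul hdx₁0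
      -- theta side
      have hT : Θ (ρ q) (γ • τ) = κ ((γ 1 1 : ℤ) : ZMod (discr K).natAbs) *
          (((γ 1 0 : ℤ) : ℂ) * (τ : ℂ) + ((γ 1 1 : ℤ) : ℂ)) ^ 2 * Θ (ρ (ia q)) τ := by
        rw [hΘ _ hx₀ k₀ hk₀, hΘ _ hx₁ k₁ hk₁,
          ← fderiv_thetaCoset_apply_moeb hK σ hprim hodd hquad hζ h𝔟 h𝔞 h𝔪 b hB hsymm h00 h11 hdet
            hpos hx₁ hk₁ hγ τ]
        have hchar : (fun i => ((γ 1 1 : ℤ) : ℂ) * ((k₁ i : ℂ) / (Ideal.absNorm 𝔪 : ℕ))) =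
            fun i => (((fun i => (γ 1 1 : ℤ) * k₁ i) i : ℤ) : ℂ) / M := by
          funext i; push_cast; ring
        rw [hchar]
        congr 2
        funext z
        exact (riemannThetaChar_coset_eq_of_sub_mem b hM hk₀ hk₁' hsub _ z).symm
      -- character side
      have hC : rayClassCoeff 𝔪 ψ (Ideal.span {ρ q}) / σ (ρ q : K) =
          (rayClassCoeff 𝔪 ψ (Ideal.span {((γ 1 1 : ℤ) : 𝓞 K)}) / σ (((γ 1 1 : ℤ) : 𝓞 K) : K)) *
            (rayClassCoeff 𝔪 ψ (Ideal.span {ρ (ia q)}) / σ (ρ (ia q) : K)) := by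
        rw [← chi_mul σ 𝔪 ψ hd0 hx₁0]
        refine chi_periodic σ hψ hx₀0 hdx₁0 (h𝔟𝔪 ?_)
        have : ρ q - ((γ 1 1 : ℤ) : 𝓞 K) * ρ (ia q) = -(((γ 1 1 : ℤ) : 𝓞 K) * ρ (ia q) - ρ q) := by ring
        rw [this]; exact 𝔟.neg_mem hsub
      simp only [hg]
      rw [hT, hC, hK₀]
      ring
  -- summation
  rw [hsumS (γ • τ), hsumS τ, Finset.sum_congr rfl hterm, ← Finset.mul_sum, hK₀]
  congr 1
  exact Finset.sum_nbij' ia jd hS_ia hS_jd hji hij (fun q _ => rfl)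

end Summit.BirchSwinnertonDyer.BirchSwinnertonDyer.Theorems.HeckeTheta

end
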